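import Summits.ResolutionOfSingularities.ResolutionOfSingularities.Theses.WildQuotients
import Literature.AlgebraicGeometry.Resolution.ResolutionOfCurves
import Literature.AlgebraicGeometry.Resolution.AlterationsDescentStage
import Literature.AlgebraicGeometry.Resolution.TameQuotientSingularitiesResolution
import Literature.AlgebraicGeometry.Resolution.SmoothOfRegularPerfectField
import Literature.AlgebraicGeometry.Resolution.ProjectiveSpaceRegular
import HarnessLib

/-!
# `WildQuotients.TameQuotientResolution` (stmt-ResolutionOfSingularities-15645) — reductions

Route `ResolutionOfSingularities/WildQuotients`, support item `TameQuotientResolution` (rank 9):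
resolution of Galois-type quotients `X₁` of a REGULAR integral `X'` by a finite group `G` of order
prime to `p` over a PERFECT field `k` of characteristic `p` (the tame instance of the crux
`WildQuotientResolution`; in print Bergh–Rydh 2019, Thm. 5, through the normalisation `X'/G` of
`X₁`). This file records, sorry-free, the reductions available in the tree today (helpers,
`--supports`; none of them closes the item):

* `tameQuotientResolution_of_wildQuotientResolution` — the item is an instance of the crux
  `WildQuotientResolution` (stmt-ResolutionOfSingularities-15640): forget `PerfectField k` and the
  coprimality.
* `tameQuotientResolution_of_dim_le_three` — KNOWN range modulo the named fact
  `Literature.AlgebraicGeometry.Resolution.CossartPiltant2019` (Cossart–Piltant 2019, Thm. 1.1):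
  every `X₁` of topological Krull dimension `≤ 3`, whatever the cover.
* `tameQuotientResolution_of_dim_le_one` — UNCONDITIONAL in dimension `≤ 1`: an integral
  finite-type `k`-scheme of dimension `≤ 1` is resolved by its normalisation
  (`hasResolution_of_dim_le_one`).
* `tameQuotientResolution_of_etale` — UNCONDITIONAL when the cover `q : X' → X₁` is étale
  everywhere (the dense open `U` of the item is all of `X₁`): regularity descends along the flat
  surjective `q` (Matsumura Thm. 23.7 (i), `DeJong1996.Stage.isRegular_of_flat_surjective`), so
  `X₁` is regular and is its own resolution.

What is NOT here (the content of the item): Bergh–Rydh's destackification for a general finite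
group of order invertible in `k` (the tree vendors the diagonalizable case only,
`BerghRydh2019_diagonalizableQuotientResolution`), and the identification of `X'/G → X₁` as a
birational (normalisation) map from the item's hypothesis "the fibres of `q` are the `G`-orbits of
the points of `X'`" — see the item's evidence note.
-/

-- single-problem summit: the doubled namespace component `ResolutionOfSingularities` is forced
set_option linter.dupNamespace false

namespace Summit.ResolutionOfSingularities.ResolutionOfSingularities.Theorems

open CategoryTheory AlgebraicGeometry
open Literature.AlgebraicGeometry.Resolution

/-- `TameQuotientResolution` is an instance of the crux `WildQuotientResolution`: resolution of
every Galois-type quotient of a regular integral scheme by a finite group over any field of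
characteristic `p` gives, in particular, the case of a perfect field and a group of order prime
to `p`. [folklore] -/
theorem tameQuotientResolution_of_wildQuotientResolution
    (hWQ : Theses.WildQuotients.WildQuotientResolution) :
    Theses.WildQuotients.TameQuotientResolution := by
  unfold Theses.WildQuotients.TameQuotientResolution
  intro p hp k _ _ _ X' X₁ f q G _ _ ρ _
  exact hWQ p hp k X' X₁ f q G ρ

/-- The known range of `TameQuotientResolution` by dimension: assuming the named fact
`CossartPiltant2019` (Cossart–Piltant, *Resolution of singularities of arithmetical threefolds*,
J. Algebra 529 (2019), Thm. 1.1), every integral separated finite-type `X₁` over a field of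
characteristic `p` with `topologicalKrullDim X₁ ≤ 3` has a resolution — whatever the regular cover
`q : X' ⟶ X₁`, the group and its action. The binders are those of
`Theses.WildQuotients.TameQuotientResolution` verbatim, followed by the dimension bound.
[cite: CossartPiltant2019, Thm. 1.1] -/
theorem tameQuotientResolution_of_dim_le_three (h : CossartPiltant2019.{0}) :
    ∀ p : ℕ, p.Prime → ∀ (k : Type) [Field k] [CharP k p] [PerfectField k]
      (X' X₁ : AlgebraicGeometry.Scheme.{0}) (f : X₁ ⟶ AlgebraicGeometry.Spec (.of k))
      (q : X' ⟶ X₁) (G : Type) [Group G] [Finite G] (ρ : G →* CategoryTheory.Aut X'),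
      Nat.Coprime (Nat.card G) p → AlgebraicGeometry.IsSeparated f →
      AlgebraicGeometry.LocallyOfFiniteType f → AlgebraicGeometry.QuasiCompact f →
      AlgebraicGeometry.IsIntegral X₁ → AlgebraicGeometry.IsIntegral X' →
      Literature.AlgebraicGeometry.Resolution.Scheme.IsRegular X' → AlgebraicGeometry.IsFinite q →
      Function.Surjective q.base →
      (∃ U : X₁.Opens, Dense (U : Set X₁) ∧
        AlgebraicGeometry.Etale (AlgebraicGeometry.morphismRestrict q U)) →
      (∀ g : G, CategoryTheory.CategoryStruct.comp (ρ g).hom q = q) →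
      (∀ x y : X', q.base x = q.base y → ∃ g : G, (ρ g).hom.base x = y) →
      topologicalKrullDim X₁ ≤ 3 →
      Literature.AlgebraicGeometry.Resolution.Scheme.HasResolution X₁ := by
  intro p _ k _ _ _ X' X₁ f q G _ _ ρ _ hsep hloc hqc hint _ _ _ _ _ _ _ hdim
  haveI := hsep; haveI := hloc; haveI := hqc; haveI := hint
  exact hasResolution_of_dim_le_three (p := p) h k X₁ f hdim

/-- `TameQuotientResolution` in dimension `≤ 1`, unconditionally: an integral scheme of finite type
over a field of dimension `≤ 1` is resolved by its normalisation (`hasResolution_of_dim_le_one`: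
one-dimensional normal Noetherian domains are regular and the normalisation of a variety is
finite) — the cover `q`, the group and the perfectness of `k` are not used. Binders of
`Theses.WildQuotients.TameQuotientResolution` verbatim, followed by the dimension bound.
[folklore] -/
theorem tameQuotientResolution_of_dim_le_one :
    ∀ p : ℕ, p.Prime → ∀ (k : Type) [Field k] [CharP k p] [PerfectField k]
      (X' X₁ : AlgebraicGeometry.Scheme.{0}) (f : X₁ ⟶ AlgebraicGeometry.Spec (.of k))
      (q : X' ⟶ X₁) (G : Type) [Group G] [Finite G] (ρ : G →* CategoryTheory.Aut X'),
      Nat.Coprime (Nat.card G) p → AlgebraicGeometry.IsSeparated f →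
      AlgebraicGeometry.LocallyOfFiniteType f → AlgebraicGeometry.QuasiCompact f →
      AlgebraicGeometry.IsIntegral X₁ → AlgebraicGeometry.IsIntegral X' →
      Literature.AlgebraicGeometry.Resolution.Scheme.IsRegular X' → AlgebraicGeometry.IsFinite q →
      Function.Surjective q.base →
      (∃ U : X₁.Opens, Dense (U : Set X₁) ∧
        AlgebraicGeometry.Etale (AlgebraicGeometry.morphismRestrict q U)) →
      (∀ g : G, CategoryTheory.CategoryStruct.comp (ρ g).hom q = q) →
      (∀ x y : X', q.base x = q.base y → ∃ g : G, (ρ g).hom.base x = y) →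
      topologicalKrullDim X₁ ≤ 1 →
      Literature.AlgebraicGeometry.Resolution.Scheme.HasResolution X₁ := by
  intro p _ k _ _ _ X' X₁ f q G _ _ ρ _ _ hloc hqc hint _ _ _ _ _ _ _ hdim
  haveI := hloc; haveI := hqc; haveI := hint
  exact hasResolution_of_dim_le_one X₁ f hdim

/-- **Regularity descends along an étale (indeed any flat) surjective morphism onto a scheme
locally of finite type over a field**: if `q : X' → X₁` is flat and surjective, `X'` is regular
and `X₁` is locally of finite type over a field, then `X₁` is regular (Matsumura Thm. 23.7 (i)
stalkwise; `X₁` is locally Noetherian). [cite: Matsumura1987, Thm. 23.7 (i)] -/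
theorem isRegular_of_flat_of_surjective_of_locallyOfFiniteType {k : Type} [Field k]
    {X' X₁ : Scheme.{0}} (f : X₁ ⟶ Spec (.of k)) [LocallyOfFiniteType f] (q : X' ⟶ X₁) [Flat q]
    (hsurj : Function.Surjective q.base) (hreg : Scheme.IsRegular X') : Scheme.IsRegular X₁ := by
  haveI : IsLocallyNoetherian X₁ := LocallyOfFiniteType.isLocallyNoetherian f
  haveI : Surjective q := ⟨hsurj⟩
  exact DeJong1996.Stage.isRegular_of_flat_surjective q hreg

/-- `TameQuotientResolution` when the cover is étale EVERYWHERE, unconditionally: if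
`q : X' → X₁` is étale (hence flat) and surjective with `X'` regular, then `X₁` is regular
(descent of regularity, Matsumura Thm. 23.7 (i)) and is its own resolution. Binders of
`Theses.WildQuotients.TameQuotientResolution` verbatim, followed by `Etale q`.
[cite: Matsumura1987, Thm. 23.7 (i)] -/
theorem tameQuotientResolution_of_etale :
    ∀ p : ℕ, p.Prime → ∀ (k : Type) [Field k] [CharP k p] [PerfectField k]
      (X' X₁ : AlgebraicGeometry.Scheme.{0}) (f : X₁ ⟶ AlgebraicGeometry.Spec (.of k))
      (q : X' ⟶ X₁) (G : Type) [Group G] [Finite G] (ρ : G →* CategoryTheory.Aut X'),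
      Nat.Coprime (Nat.card G) p → AlgebraicGeometry.IsSeparated f →
      AlgebraicGeometry.LocallyOfFiniteType f → AlgebraicGeometry.QuasiCompact f →
      AlgebraicGeometry.IsIntegral X₁ → AlgebraicGeometry.IsIntegral X' →
      Literature.AlgebraicGeometry.Resolution.Scheme.IsRegular X' → AlgebraicGeometry.IsFinite q →
      Function.Surjective q.base →
      (∃ U : X₁.Opens, Dense (U : Set X₁) ∧
        AlgebraicGeometry.Etale (AlgebraicGeometry.morphismRestrict q U)) →
      (∀ g : G, CategoryTheory.CategoryStruct.comp (ρ g).hom q = q) →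
      (∀ x y : X', q.base x = q.base y → ∃ g : G, (ρ g).hom.base x = y) →
      AlgebraicGeometry.Etale q →
      Literature.AlgebraicGeometry.Resolution.Scheme.HasResolution X₁ := by
  intro p _ k _ _ _ X' X₁ f q G _ _ ρ _ _ hloc _ _ _ hreg _ hsurj _ _ _ het
  haveI := hloc; haveI := het
  exact (isRegular_of_flat_of_surjective_of_locallyOfFiniteType f q hsurj hreg).hasResolution

/-! ## The chart form of the item, modulo Bergh–Rydh (repair R2 of the evidence note)

The planner's gloss of the item is "X′ regular = smooth, X′/G has finite tame quotient singularities
[Bergh–Rydh 2019, Thm. 5]". Phrased on the quotient `Y` through Zariski-local charts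
`Spec S^G ⟶ Y` over `k` (`S` a REGULAR finitely generated `k`-algebra, `G` finite of order prime
to `p` acting by `k`-algebra automorphisms — the chart language of the sibling route
`WildQuotient`), the statement is the named fact
`Literature.AlgebraicGeometry.Resolution.BerghRydh2019_tameQuotientResolution` up to two
dictionary entries, both proved here: a regular finitely generated algebra over a perfect field is
smooth (`algebraSmooth_of_isRegularRing_of_perfectField`, Matsumura §30 Rem. 2 / Stacks 00TV at
ring level), and `p ∤ |G|` means `|G| ≠ 0` in `k` (`natCast_ne_zero_of_coprime`). -/

/-- **A regular finitely generated algebra over a perfect field is smooth** (ring-level form of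
`smooth_of_isRegular_of_perfectField`): `Spec S` is a regular scheme (`Scheme.isRegular_Spec`),
hence `Spec S → Spec k` is smooth, and smoothness of `Spec` of a ring map is smoothness of the
ring map (`HasRingHomProperty.Spec_iff`). [cite: Matsumura1987, §30 Remark 2 after Thm. 30.3] -/
theorem algebraSmooth_of_isRegularRing_of_perfectField (k : Type) [Field k] [PerfectField k]
    (S : Type) [CommRing S] [Algebra k S] [Algebra.FiniteType k S] [IsRegularRing S] :
    Algebra.Smooth k S := by
  let f : Spec (.of S) ⟶ Spec (.of k) := Spec.map (CommRingCat.ofHom (algebraMap k S))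
  haveI : LocallyOfFiniteType f :=
    (HasRingHomProperty.Spec_iff (P := @LocallyOfFiniteType)).mpr
      (RingHom.finiteType_algebraMap.mpr ‹_›)
  have hs : Smooth f := smooth_of_isRegular_of_perfectField f (Scheme.isRegular_Spec (.of S))
  exact RingHom.smooth_algebraMap.mp ((HasRingHomProperty.Spec_iff (P := @Smooth)).mp hs)

/-- In characteristic `p`, a natural number prime to `p` is non-zero in `k`. [folklore] -/
theorem natCast_ne_zero_of_coprime (k : Type) [Field k] {p : ℕ} (hp : p.Prime) [CharP k p]
    {n : ℕ} (hn : Nat.Coprime n p) : (n : k) ≠ 0 := by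
  intro h
  have hdvd : p ∣ n := (CharP.cast_eq_zero_iff k p n).mp h
  exact hp.ne_one (hn.symm.eq_one_of_dvd hdvd)

/-- **`TameQuotientResolution` in chart form (repair R2), modulo Bergh–Rydh 2019 Thm. 5.**
Assuming the named fact `BerghRydh2019_tameQuotientResolution`: for every prime `p`, every
perfect field `k` of characteristic `p` and every integral separated `k`-scheme `Y` of finite type
such that every point of `Y` lies in the image of an open immersion `Spec S^G ⟶ Y` OVER `k`, where
`S` is a regular finitely generated `k`-algebra and `G` is a finite group of order prime to `p`
acting on `S` by `k`-algebra automorphisms (`S^G = FixedPoints.subalgebra k S G`), the scheme `Y`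
has a resolution of singularities. (Open immersions are étale; regular = smooth over the perfect
`k`; `p ∤ |G|` ⇒ `|G| ∈ kˣ`.) This is the statement the item's gloss describes ("X′/G has finite
tame quotient singularities … Bergh–Rydh"), with the quotient presented by charts instead of by a
cover `q : X′ → X₁` with orbit fibres. [cite: BerghRydh2019, Thm 5 (arXiv:1905.00872, p. 4)] -/
theorem hasResolution_of_tame_regular_charts (hBR : BerghRydh2019_tameQuotientResolution) :
    ∀ p : ℕ, p.Prime → ∀ (k : Type) [Field k] [CharP k p] [PerfectField k]
      (Y : AlgebraicGeometry.Scheme.{0}) (g : Y ⟶ AlgebraicGeometry.Spec (.of k)),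
      AlgebraicGeometry.IsSeparated g → AlgebraicGeometry.LocallyOfFiniteType g →
      AlgebraicGeometry.QuasiCompact g → AlgebraicGeometry.IsIntegral Y →
      (∀ y : Y, ∃ (G : Type) (_ : Group G) (_ : Finite G) (S : Type) (_ : CommRing S)
        (_ : Algebra k S) (_ : MulSemiringAction G S) (_ : SMulCommClass G k S),
        Nat.Coprime (Nat.card G) p ∧ Algebra.FiniteType k S ∧ IsRegularRing S ∧
        ∃ φ : AlgebraicGeometry.Spec (.of (FixedPoints.subalgebra k S G)) ⟶ Y,
          AlgebraicGeometry.IsOpenImmersion φ ∧ y ∈ Set.range φ.base ∧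
          CategoryTheory.CategoryStruct.comp φ g =
            AlgebraicGeometry.Spec.map (CommRingCat.ofHom
              (algebraMap k (FixedPoints.subalgebra k S G)))) →
      Literature.AlgebraicGeometry.Resolution.Scheme.HasResolution Y := by
  intro p hp k _ _ _ Y g hsep hloc hqc hint hcharts
  haveI := hsep; haveI := hloc; haveI := hqc; haveI := hint
  refine hBR k Y g fun y => ?_
  obtain ⟨G, _, _, S, _, _, _, _, hcop, hft, hreg, φ, hφ, hy, hcomp⟩ := hcharts y
  haveI := hft; haveI := hreg; haveI := hφ
  exact ⟨G, inferInstance, inferInstance, S, inferInstance, inferInstance, inferInstance,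
    inferInstance, natCast_ne_zero_of_coprime k hp hcop, hft,
    algebraSmooth_of_isRegularRing_of_perfectField k S, φ, inferInstance, hy, hcomp⟩

/-! ## The Galois clause (repair R1): invariants with a single conjugate are rational

The algebraic heart of "G transitive on the geometric generic points of `X′` over `X₁` ⟹
`k(X′)^G = k(X₁)` ⟹ `X′/G → X₁` birational" (the clause of
`Literature.AlgebraicGeometry.Resolution.DeJong1997_galoisAlteration`, recommended as repair R1 of
the item): for a finite separable extension `L/K` and an algebraically closed `Ω ⊇ K`, an element
of `L` on which all `K`-embeddings `L → Ω` agree lies in `K` (its separable minimal polynomial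
has a single root), hence every invariant of a group of `K`-automorphisms of `L` that permutes
the `K`-embeddings `L → Ω` transitively lies in `K`. No use of Artin's theorem or of faithfulness
of the action is needed. -/

/-- **An element with a single conjugate is rational.** Let `L/K` be a separable algebraic field
extension, `Ω` an algebraically closed field over `K`, and `x ∈ L` such that `a x = b x` for all
`K`-algebra maps `a b : L → Ω`. Then `x ∈ K`: the images of `x` under the `K`-embeddings are
exactly the roots of `minpoly K x` in `Ω` (`Algebra.IsAlgebraic.range_eval_eq_rootSet_minpoly`),
a separable polynomial has `natDegree`-many of them, so the minimal polynomial is linear.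
[folklore] -/
theorem mem_range_algebraMap_of_forall_algHom_apply_eq {K L Ω : Type*} [Field K] [Field L]
    [Field Ω] [Algebra K L] [Algebra K Ω] [IsAlgClosed Ω] [Algebra.IsSeparable K L] {x : L}
    (hx : ∀ a b : L →ₐ[K] Ω, a x = b x) : x ∈ (algebraMap K L).range := by
  classical
  haveI : Algebra.IsAlgebraic K L := Algebra.IsSeparable.isAlgebraic K L
  let a : L →ₐ[K] Ω := IsAlgClosed.lift
  have hrange : (Set.range fun ψ : L →ₐ[K] Ω ↦ ψ x) = {a x} := by
    refine Set.eq_singleton_iff_unique_mem.mpr ⟨⟨a, rfl⟩, ?_⟩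
    rintro _ ⟨b, rfl⟩
    exact hx b a
  have hroot : (minpoly K x).rootSet Ω = {a x} := by
    rw [← Algebra.IsAlgebraic.range_eval_eq_rootSet_minpoly Ω x, hrange]
  have hsep : (minpoly K x).Separable := Algebra.IsSeparable.isSeparable K x
  have hsplit : Polynomial.Splits ((minpoly K x).map (algebraMap K Ω)) := IsAlgClosed.splits _
  have h1 : (minpoly K x).natDegree = 1 := by
    rw [← Polynomial.card_rootSet_eq_natDegree hsep hsplit, Fintype.card_eq_nat_card]
    simp only [hroot]
    simp
  exact minpoly.natDegree_eq_one_iff.mp h1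

/-- **Invariants of a group transitive on the embeddings are rational** (the field-level content
of de Jong's "Galois alteration" clause, Bergh–Rydh 2019 §1: "`(X′, G)` is a Galois alteration if
… `K(X′)^G/K(X)` is purely inseparable", in the separable = generically étale case): if a group
`G` acts on the separable algebraic extension `L/K` by `K`-algebra automorphisms and permutes the
`K`-embeddings `L → Ω` into an algebraically closed field transitively, then `L^G = K`.
[folklore] -/
theorem mem_range_algebraMap_of_smul_eq_of_transitive {K L Ω : Type*} [Field K] [Field L]
    [Field Ω] [Algebra K L] [Algebra K Ω] [IsAlgClosed Ω] [Algebra.IsSeparable K L]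
    {G : Type*} [Group G] [MulSemiringAction G L] [SMulCommClass G K L]
    (htrans : ∀ a b : L →ₐ[K] Ω, ∃ g : G, a.comp (MulSemiringAction.toAlgHom K L g) = b)
    {x : L} (hx : ∀ g : G, g • x = x) : x ∈ (algebraMap K L).range := by
  refine mem_range_algebraMap_of_forall_algHom_apply_eq (Ω := Ω) fun a b => ?_
  obtain ⟨g, rfl⟩ := htrans a b
  simp [hx g]

end Summit.ResolutionOfSingularities.ResolutionOfSingularities.Theorems
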